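import Literature.InformationTheory.QuantumCodes.SyndromeDecodingCSSPauli
import HarnessLib

/-!
# The optimal correction radius of a CSS code, `⌊(d − 1)/2⌋`, packaged as a predicate and read off `[[n, k, d]]`

Topic `InformationTheory/QuantumCodes`; namespace `Literature.InformationTheory.QuantumCodes.CSSCode`.
`SyndromeDecodingCSSPauli.lean` proves (`CSSCode.optimalRadius`) that for a check-matrix CSS code on the qubits `Fin n`
with an `X`- and a `Z`-logical, SOME Pauli decoder (sector-wise minimum-weight decoding, an explicitly specified
function of the syndrome) has correction radius EXACTLY `⌊(min d^X d^Z − 1)/2⌋` in symplectic weight, and that NO Pauli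
decoder — no function of the syndrome whatsoever, sector-wise or not — corrects every Pauli error of a larger weight.
This file NAMES that conclusion, `CSSCode.HasOptimalRadius C t` («the optimal correction radius of `C` is `t`, and it
is attained»), so that a census row states it in one line, and derives it from type-02's census predicate
`CSSCode.IsCode C n k d` (`[[n, k, d]]`, exact distance through Tillich–Zémor's `cssMinDist`):
`IsCode C n k d → HasOptimalRadius C ⌊(d − 1)/2⌋` — Gottesman §2.3: "to correct t errors, a code must have distance at
least 2t+1"; Nielsen–Chuang p. 467: "a code with distance at least 2t+1 … is able to correct arbitrary errors on any
t qubits"; Delfosse–Nickerson §3: "both of these bounds are tight".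

Statements (all PROVED; elementary consequences of the three imported decoding files):
* `HasOptimalRadius` (definition), `hasOptimalRadius_iff` (unfolding), `HasOptimalRadius.unique`;
* `hasOptimalRadius_of_logicals` / `hasOptimalRadius_iff_eq` — with an `X`- and a `Z`-logical the optimal radius is
  `⌊(min d^X d^Z − 1)/2⌋` and only that number; `hasOptimalRadius_of_k_pos` (`0 < k` suffices);
  `hasOptimalRadius_minDistance` (read against the stabilizer-code distance `minDistance C.toSympCode`);
* `IsCode.hasOptimalRadius` — an `[[n, k, d]]` code has optimal radius `⌊(d − 1)/2⌋`; `IsCode.hasOptimalRadius_of_eq`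
  takes the radius as a numeral `t` with the side condition `(d − 1)/2 = t`;
* sector corollaries of `[[n, k, d]]` over ANY qubit index type (no symplectic picture needed):
  `IsCode.minWeight_correctsUpToX`, `IsCode.minWeight_correctsUpToZ` (minimum-weight sector decoding corrects every bit-flip resp. phase-flip pattern of weight
  `≤ ⌊(d−1)/2⌋`) and `IsCode.le_half_of_correctsUpTo_sectors` (no PAIR of sector decoders both correct `t` errors for a
  `t > ⌊(d−1)/2⌋`).

HONEST FRAMING: no code parameter is asserted here; nothing probabilistic (thresholds are the VALIDATED column elsewhere).
The decoder attaining the radius is minimum-weight decoding as a specified (noncomputable) function; explicit decoder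
TABLES with a kernel-checked radius are a different lane (the qec cell's `Summits/Ventures/QEC/Decoders/RadiusCheck*.lean`).

## References
* [Gottesman1997] D. Gottesman, PhD thesis, arXiv:quant-ph/9705052, §2.3 (chunk p0014 L3).
* [NielsenChuang2010] Nielsen–Chuang, 10th anniversary ed., §10.5.5 p. 467 (held chunk p0549 L1).
* [DelfosseNickerson2021] N. Delfosse, N. H. Nickerson, Quantum 5 (2021) 595, §3 ¶2 (chunk p0006 L8–13).
-/

namespace Literature.InformationTheory.QuantumCodes.CSSCode

/-! ## The predicate (qubits `Fin n`, Pauli errors in the symplectic picture) -/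

section Pauli

variable {n : ℕ} {RX RZ : Type*} [Fintype RX] [Fintype RZ]

/-- **`t` is the optimal correction radius of the CSS code `C`, and it is attained** (qubits `Fin n`; Pauli errors
`(a|b) ∈ 𝔽₂ⁿ × 𝔽₂ⁿ` weighed by symplectic weight; syndrome = the pair (`H^Z a`, `H^X b`); success = the net operation
lies in the stabilizer space `S̄ = rs H^X × rs H^Z`, degenerate corrections counted as successes): SOME Pauli decoder —
a function from syndromes to corrections — has correction radius exactly `t` (`Decoder.IsCorrectionRadius`: every error
of weight `≤ t` corrected, not every error of weight `≤ t + 1`), and NO Pauli decoder corrects every error of weight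
`≤ t'` for a `t' > t` ("a code with distance at least 2t+1 … is able to correct arbitrary errors on any t qubits";
"both of these bounds are tight"). (definition)
[cite: NielsenChuang2010, §10.5.5 p. 467 (held chunk p0549 L1)] -/
def HasOptimalRadius (C : CSSCode RX RZ (Fin n)) (t : ℕ) : Prop :=
  (∃ D : Decoder ((RZ → ZMod 2) × (RX → ZMod 2)) (SympVec n),
      D.IsCorrectionRadius (cssSyndrome C.xSyndrome C.zSyndrome) (C.toSympCode : Set (SympVec n)) sympWeight t) ∧
    ∀ (D : Decoder ((RZ → ZMod 2) × (RX → ZMod 2)) (SympVec n)) (t' : ℕ),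
      D.CorrectsUpTo (cssSyndrome C.xSyndrome C.zSyndrome) (C.toSympCode : Set (SympVec n)) sympWeight t' → t' ≤ t

/-- Unfolding `HasOptimalRadius`: attained by some decoder (radius exactly `t`) and unbeatable by every decoder.
[cite: NielsenChuang2010, §10.5.5 p. 467 (held chunk p0549 L1)] -/
theorem hasOptimalRadius_iff (C : CSSCode RX RZ (Fin n)) (t : ℕ) :
    C.HasOptimalRadius t ↔
      (∃ D : Decoder ((RZ → ZMod 2) × (RX → ZMod 2)) (SympVec n),
          D.IsCorrectionRadius (cssSyndrome C.xSyndrome C.zSyndrome) (C.toSympCode : Set (SympVec n)) sympWeight t) ∧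
        ∀ (D : Decoder ((RZ → ZMod 2) × (RX → ZMod 2)) (SympVec n)) (t' : ℕ),
          D.CorrectsUpTo (cssSyndrome C.xSyndrome C.zSyndrome) (C.toSympCode : Set (SympVec n)) sympWeight t' →
            t' ≤ t :=
  Iff.rfl

/-- The optimal correction radius of a CSS code is unique. [cite: DelfosseNickerson2021, §3 ¶2 (chunk p0006 L12–13: "both of these bounds are tight")] -/
theorem HasOptimalRadius.unique {C : CSSCode RX RZ (Fin n)} {t t' : ℕ} (h : C.HasOptimalRadius t)
    (h' : C.HasOptimalRadius t') : t = t' := by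
  obtain ⟨⟨D, hD⟩, hmax⟩ := h
  obtain ⟨⟨D', hD'⟩, hmax'⟩ := h'
  exact le_antisymm (hmax' D t hD.1) (hmax D' t' hD'.1)

/-- **The optimal radius is `⌊(min d^X d^Z − 1)/2⌋`** for a CSS code with an `X`- and a `Z`-logical — the packaged
form of `CSSCode.optimalRadius` (attained by sector-wise minimum-weight decoding; unbeatable). (proved)
[cite: Gottesman1997, §2.3 (chunk p0014 L3)] [cite: DelfosseNickerson2021, §3 ¶2 (chunk p0006 L8–13)] -/
theorem hasOptimalRadius_of_logicals (C : CSSCode RX RZ (Fin n))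
    (hX : ∃ v : Fin n → ZMod 2, C.HZ.mulVec v = 0 ∧ v ∉ C.rowSpX)
    (hZ : ∃ v : Fin n → ZMod 2, C.HX.mulVec v = 0 ∧ v ∉ C.rowSpZ) :
    C.HasOptimalRadius ((min C.dX C.dZ - 1) / 2) :=
  C.optimalRadius hX hZ

/-- … and ONLY that number: `HasOptimalRadius C t ↔ t = ⌊(min d^X d^Z − 1)/2⌋` (with both logicals). (proved)
[cite: DelfosseNickerson2021, §3 ¶2 (chunk p0006 L8–13)] -/
theorem hasOptimalRadius_iff_eq (C : CSSCode RX RZ (Fin n))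
    (hX : ∃ v : Fin n → ZMod 2, C.HZ.mulVec v = 0 ∧ v ∉ C.rowSpX)
    (hZ : ∃ v : Fin n → ZMod 2, C.HX.mulVec v = 0 ∧ v ∉ C.rowSpZ) {t : ℕ} :
    C.HasOptimalRadius t ↔ t = (min C.dX C.dZ - 1) / 2 :=
  ⟨fun h => h.unique (C.hasOptimalRadius_of_logicals hX hZ), fun h => h ▸ C.hasOptimalRadius_of_logicals hX hZ⟩

/-- With a logical qubit (`0 < k`) both logicals exist, so the optimal radius is `⌊(min d^X d^Z − 1)/2⌋`. (proved)
[cite: Gottesman1997, §2.3 (chunk p0014 L3)] -/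
theorem hasOptimalRadius_of_k_pos (C : CSSCode RX RZ (Fin n)) (hk : 0 < C.k) :
    C.HasOptimalRadius ((min C.dX C.dZ - 1) / 2) :=
  C.hasOptimalRadius_of_logicals (C.dX_pos_iff.1 (C.dX_pos_of_k_pos hk)) (C.dZ_pos_iff.1 (C.dZ_pos_of_k_pos hk))

/-- The same read against the **distance of the stabilizer code** `S̄ = C.toSympCode` (`minDistance_toSympCode :
minDistance S̄ = min d^X d^Z`): the optimal radius is `⌊(d − 1)/2⌋`. (proved)
[cite: NielsenChuang2010, §10.5.5 p. 467 (held chunk p0549 L1: "a code with distance at least 2t+1 … is able to correct arbitrary errors on any t qubits")] -/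
theorem hasOptimalRadius_minDistance (C : CSSCode RX RZ (Fin n)) (hk : 0 < C.k) :
    C.HasOptimalRadius ((minDistance C.toSympCode - 1) / 2) := by
  rw [C.minDistance_toSympCode]
  exact C.hasOptimalRadius_of_k_pos hk

/-- **An `[[n, k, d]]` CSS code has optimal correction radius `⌊(d − 1)/2⌋`, attained** (from type-02's census
predicate: `k > 0` and `min d^X d^Z = d`). (proved)
[cite: Gottesman1997, §2.3 (chunk p0014 L3: "to correct t errors … distance at least 2t+1"; L5-8: "[[n,k,d]]")]
[cite: DelfosseNickerson2021, §3 ¶2 (chunk p0006 L8–13)] -/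
theorem IsCode.hasOptimalRadius {C : CSSCode RX RZ (Fin n)} {m k d : ℕ} (h : C.IsCode m k d) :
    C.HasOptimalRadius ((d - 1) / 2) := by
  have hk : 0 < C.k := h.2.1.symm ▸ h.k_pos
  obtain ⟨-, -, hmin⟩ := (C.isCode_iff hk).1 h
  rw [← hmin]
  exact C.hasOptimalRadius_of_k_pos hk

/-- Numeral form: an `[[n, k, d]]` code has optimal correction radius `t` whenever `(d − 1)/2 = t` (a `rfl`/`decide`
side goal per census row). (proved) [cite: Gottesman1997, §2.3 (chunk p0014 L3)] -/
theorem IsCode.hasOptimalRadius_of_eq {C : CSSCode RX RZ (Fin n)} {m k d t : ℕ} (h : C.IsCode m k d)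
    (ht : (d - 1) / 2 = t) : C.HasOptimalRadius t :=
  ht ▸ h.hasOptimalRadius

end Pauli

/-! ## Sector corollaries of `[[n, k, d]]` over any qubit index type -/

section Sector

variable {RX RZ Q : Type*} [Fintype Q] [Fintype RX] [Fintype RZ]

/-- **Minimum-weight `X`-decoding of an `[[n, k, d]]` code corrects every bit-flip pattern of weight `≤ ⌊(d−1)/2⌋`**
(`d ≤ d^X`). (proved) [cite: DelfosseNickerson2021, §3 ¶2 (chunk p0006 L8–9: "up to (d−1)/2")] -/
theorem IsCode.minWeight_correctsUpToX {C : CSSCode RX RZ Q} {m k d : ℕ} (h : C.IsCode m k d) :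
    (Decoder.minWeight C.xSyndrome hammingNorm).CorrectsUpTo C.xSyndrome (C.rowSpX : Set (Q → ZMod 2)) hammingNorm
      ((d - 1) / 2) := by
  have hk : 0 < C.k := h.2.1.symm ▸ h.k_pos
  have hdX := C.dX_pos_of_k_pos hk
  have hle := h.le_dX_and_le_dZ.1
  exact C.minWeight_correctsUpToX (by omega)

/-- **Minimum-weight `Z`-decoding of an `[[n, k, d]]` code corrects every phase-flip pattern of weight `≤ ⌊(d−1)/2⌋`**
(`d ≤ d^Z`). (proved) [cite: DelfosseNickerson2021, §3 ¶2 (chunk p0006 L8–9)] -/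
theorem IsCode.minWeight_correctsUpToZ {C : CSSCode RX RZ Q} {m k d : ℕ} (h : C.IsCode m k d) :
    (Decoder.minWeight C.zSyndrome hammingNorm).CorrectsUpTo C.zSyndrome (C.rowSpZ : Set (Q → ZMod 2)) hammingNorm
      ((d - 1) / 2) := by
  have hk : 0 < C.k := h.2.1.symm ▸ h.k_pos
  have hdZ := C.dZ_pos_of_k_pos hk
  have hle := h.le_dX_and_le_dZ.2.1
  exact C.minWeight_correctsUpToZ (by omega)

/-- **Tightness at sector level for an `[[n, k, d]]` code**: no PAIR of sector decoders (any function of the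
`Z`-check syndrome for bit flips, any function of the `X`-check syndrome for phase flips) both correct every pattern of
weight `≤ t` when `t > ⌊(d−1)/2⌋` — one sector has distance exactly `d`. (proved)
[cite: DelfosseNickerson2021, §3 ¶2 (chunk p0006 L12–13: "both of these bounds are tight")] -/
theorem IsCode.le_half_of_correctsUpTo_sectors {C : CSSCode RX RZ Q} {m k d : ℕ} (h : C.IsCode m k d)
    {DX : Decoder (RZ → ZMod 2) (Q → ZMod 2)} {DZ : Decoder (RX → ZMod 2) (Q → ZMod 2)} {t : ℕ}
    (hDX : DX.CorrectsUpTo C.xSyndrome (C.rowSpX : Set (Q → ZMod 2)) hammingNorm t)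
    (hDZ : DZ.CorrectsUpTo C.zSyndrome (C.rowSpZ : Set (Q → ZMod 2)) hammingNorm t) : t ≤ (d - 1) / 2 := by
  have hk : 0 < C.k := h.2.1.symm ▸ h.k_pos
  obtain ⟨-, -, hmin⟩ := (C.isCode_iff hk).1 h
  have h1 := C.two_mul_lt_dX_of_correctsUpToX hDX (C.dX_pos_iff.1 (C.dX_pos_of_k_pos hk))
  have h2 := C.two_mul_lt_dZ_of_correctsUpToZ hDZ (C.dZ_pos_iff.1 (C.dZ_pos_of_k_pos hk))
  rcases min_choice C.dX C.dZ with hc | hc <;> omega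

end Sector

end Literature.InformationTheory.QuantumCodes.CSSCode
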